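import Literature.AlgebraicGeometry.AbelianSchemes.TorsionBlockEtaleOfLieSignature
import Literature.AlgebraicGeometry.GroupSchemes.CartierDualBlockDuality
import Literature.AlgebraicGeometry.AbelianSchemes.WeilPairingIso
import Literature.AlgebraicGeometry.AbelianSchemes.WeilDualityPolarizationTransport
import Literature.AlgebraicGeometry.AbelianSchemes.DualPairDimEq
import Literature.AlgebraicGeometry.AbelianSchemes.PolarizationUnitHypothesis
import Literature.AlgebraicGeometry.AbelianSchemes.SerreTensorIsogeny
import Literature.AlgebraicGeometry.Motives.AbelianVarietyFrobeniusKernelTorsion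
import Literature.AlgebraicGeometry.Motives.AbelianVarietyTorsionFrobeniusPins
import Literature.RingTheory.DedekindDomain.BlockIdempotentFamily
import HarnessLib

/-!
# The banal-block Frobenius-kernel law on a PEL abelian scheme with unmixed frame: `Ker F^{(f)} ∩ A[u^∞] = A[𝔞] ∩ A[u^∞]`
# ([Shimura 1998] §13.1 Thm. 1, §18.6; [Tate 1997] (3.7)–(3.8); [Mumford AV] §15, §20; [Rapoport–Smithling–Zhang 2020] §4.1)

Topic `Literature/AlgebraicGeometry/AbelianSchemes`; namespace `Literature.AlgebraicGeometry.AbelianSchemes.AbelianSchemeOver` (§1 in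
`….RingAction`, two ring-side lemmas in `Literature.RingTheory.DedekindDomain`).  THEOREMS ONLY (no definition, no named fact, no instance,
no notation, no `sorry`).  Cell `hodgecm-mathlib` (D-0151), FLOOR 0, P6 «MOD programme» (crux hLiu418 = stmt-HodgeConjecture-24832, `--supports`,
count-neutral): organ **«BANAL BLOCK FROBENIUS KERNEL ON A KOTTWITZ FAMILY WITH UNMIXED FRAME»** (LEAD F0P6-plan (g3) «M-57c» 2026-09-02T02:16Z,
the P-SIDE payment of row 38 (π2-G) `RGDInputsAt.frobKernel_banal` of the spine `Cruxes/HLiu418/Lines/F0_P6a_RGDAssembly.lean` ED. 4: the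
conclusion of its helper `FrobKernelBanal₀ S Kc 𝓜 w h𝓨 e 𝒜 ρ p f 𝔞` at one special point, for ONE abelian scheme `A` over an algebraically
closed field of characteristic `p` with a ring action `ι` of `O`).  HC_CM is proved only modulo the printed citations (2 remaining named inputs
hLiu418 24832, h413 24833) until rung 0 closes; this file is generic and changes no count.

THE MATHEMATICS.  Let `u` be a maximal ideal of `O` over `p` with block data `(p) = u^e 𝔟`, `u + 𝔟 = O`, `e ≥ 1`, and block idempotents
`a_n ≡ 1 (u^{en})`, `a_n ≡ 0 (𝔟^n)` (★ `BlockIdempotentFamily`; `a_n² ≡ a_n (p^n)`).  A `T`-point `t` of `A` killed by `u^n` is killed by `[p^n]`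
(`p^n ∈ u^n`) and FIXED by `ι(a_m)` for `m ≥ n` (`a_m − 1 ∈ u^{em} ⊆ u^n`), so it lands in the `u`-BLOCK `Fix((ι a_m)[N]) ⊂ A[N]` (§2).
UNMIXED FRAME ([RapoportSmithlingZhang2020Diagonal] §4.1 (4.6), Kottwitz signature `r_τ` CONSTANT on the embeddings `τ` inducing the banal place `u`):
* ÉTALE block (`r_τ = 0` on `u`): the Lie signature of `ι(a_m)` is `0`, the block is étale (★ (C1) FILE 2 `etale_block_of_lieSignature_zero`,
  [Tate1997FiniteFlatGroupSchemes] (3.7)) and `Ker F^{(f)}_{A∕k}` meets it trivially (★ `block_comp_relFrobenius_eq_one_iff_of_lieSignature_zero`):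
  **`t ≫ F^{(f)} = 1 ↔ t = 1`** (§3).
* MULTIPLICATIVE block (`r_τ = 2 = n` on `u`, so `r = 0` on the CONJUGATE block `ū = u†` by `r_τ + r_{τc} = 2`): the `ū`-block of `A[p^f]` is étale;
  a polarization `λ` PRIME TO `p` whose Rosati involution induces `†` on `O` gives a HERMITIAN perfect duality `e₀ = ℓ ≫ w : A[p^f] ≅ A[p^f]^D`
  (`w` the Weil isomorphism `Â[q] ≅ A[q]^D`, [MumfordAV1970] §15 Thm. 1 ∕ §20, ★ `exists_weilIso'` + ★ `weilHom_natural`; `ℓ` the lift of `λ|_{A[q]}`,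
  ★ `exists_lift_lam` ∕ `isIso_lift` ∕ `hermitian_of_natural`), under which the `u`-block is Cartier dual to the étale `ū`-block, hence of multiplicative
  type and KILLED by `F^{(f)}` (★ (C1) FILE 3 `comp_comp_comp_relFrobenius_eq_one_of_etale_conjugate`, [Tate1997FiniteFlatGroupSchemes] §(3.8),
  [Demazure1972] III §6); conversely `Ker F^{(f)} ⊆ A[p^f]` (`[p^f] = F^{(f)} ≫ V^{(f)}`, [MumfordAV1970] §15, ★ (FK0)
  `comp_pow_zsmul_id_eq_one_of_comp_relFrobenius_eq_one`): **`t ≫ F^{(f)} = 1 ↔ t ≫ [p^f] = 1`** (§4).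
In print this is the banal part of [Shimura1998] §13.1 Thm. 1 ∕ §18.6 (p. 127) «`Ker F_q ∩ A[u^∞] = A[𝔭_u^{k_u}]`, `k_u = #{τ ↦ u : r_τ ≠ 0}`», read
for the twist ideal `𝔞` of a Frobenius: `u ∤ 𝔞` on étale blocks, `ord_u 𝔞 = ord_u (p^f)` on multiplicative blocks — §5 turns the two laws into the
`FrobKernelBanal₀` shape «`t ≫ F^{(f)} = 1 ↔ ∀ b ∈ 𝔞, t ≫ ι(b) = 1` on `u^n`-torsion points» under exactly these hypotheses on `𝔞`
(`u^n ⊔ 𝔞 = ⊤`, resp. `u^n ⊔ 𝔞 = u^n ⊔ (p^f)`; the valuation-table bridges are ★ `F0P6aCanonicalFrobeniusIdealBanalBridges`).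

* §1 (`RingAction`, any base) `T`-POINTS KILLED BY AN IDEAL: `comp_i_eq_self_of_sub_one_mem`, `comp_mulN_eq_one_of_natCast_mem`,
  `forall_mem_sup_iff`, `forall_mem_top_iff`, `forall_mem_span_singleton_iff`.
* §2 (any base) LANDING IN THE BLOCK: `exists_fix_torsionMap_of_comp_eq` (`[N] t = 1`, `ι(e) t = t` ⇒ `t` factors through `Fix((ι e)[N]) ↪ A[N] ↪ A`).
* §3 (`k = k̄`) ÉTALE LAW: **`comp_relFrobeniusOver_eq_one_iff_of_lieSignature_zero`** (block form: CRT idempotent `e² = e + N c`, Lie signature `0`) and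
  **`comp_relFrobeniusOver_eq_one_iff_eq_one_of_blockFamily`** (`u^n`-torsion form); ring side `exists_mul_self_eq_add_nsmul_of_blockFamily`,
  `natCast_pow_mem_pow_of_blockData`.
* §4 (`k = k̄`, characteristic `p`) MULTIPLICATIVE LAW: **`comp_relFrobeniusOver_eq_one_iff_comp_mulN_eq_one_of_conj_lieSignature_zero`** (block form)
  and **`comp_relFrobeniusOver_eq_one_iff_comp_mulN_eq_one_of_blockFamily`** (`u^n`-torsion form, `λ` prime to `p` in the (P-1) quasi-inverse currency
  `λ ≫ ν = [d]`, `p ∤ d` of the spine row `polQuasiInv`); `eq_one_of_comp_mulN_of_comp_lam_of_quasiInverse` ((P-1) ⇒ «`λ` kills no point of `A[p^f]`»).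
* §5 HEADS IN `FrobKernelBanal₀` SHAPE: **`frobKernelBanal_of_lieSignature_zero`** (étale `u`-block, `u^n ⊔ 𝔞 = ⊤`) and
  **`frobKernelBanal_of_conj_lieSignature_zero`** (multiplicative `u`-block, `u^n ⊔ 𝔞 = u^n ⊔ (p^f)`); ring side `sup_pow_eq_span_pow_sup_pow_of_eq_pow_mul`
  (`𝔞 = u^{ef} 𝔟′`, `u + 𝔟′ = O` ⇒ the multiplicative hypothesis).

## References
* [Shimura1998] G. Shimura, *Abelian Varieties with Complex Multiplication and Modular Functions* (1998), §13.1 Thm. 1 (pp. 97–99), §18.6 (p. 127).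
* [Tate1997FiniteFlatGroupSchemes] J. Tate, *Finite flat group schemes*, in: Modular Forms and Fermat's Last Theorem (1997), (3.7), §(3.8) pp. 145–146.
* [MumfordAV1970] D. Mumford, *Abelian Varieties* (1970), §15 Thm. 1 (p. 143) and p. 146, §20 (I) (pp. 184–189).
* [Demazure1972] M. Demazure, *Lectures on p-divisible groups*, LNM 302 (1972), Ch. III §6.
* [RapoportSmithlingZhang2020Diagonal] M. Rapoport, B. Smithling, W. Zhang, *Arithmetic diagonal cycles on unitary Shimura varieties*, Compos. Math.
  156 (2020), §4.1 (4.6) p. 16 and p. 17.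
* [Neukirch1999] J. Neukirch, *Algebraic Number Theory* (1999), Ch. I §3 (3.6).
-/

set_option autoImplicit false

-- Mathlib's `Over`/`Scheme` APIs are stated across semireducible wrappers (as in the ★ `GroupSchemes/*` files).
set_option backward.isDefEq.respectTransparency false

noncomputable section

universe u

open CategoryTheory CategoryTheory.Limits AlgebraicGeometry MonoidalCategory CartesianMonoidalCategory
open scoped MonObj

namespace Literature.AlgebraicGeometry.AbelianSchemes.AbelianSchemeOver

open Literature.AlgebraicGeometry.Motives Literature.AlgebraicGeometry.Motives.AbelianVariety
open Literature.AlgebraicGeometry.GroupSchemes Literature.AlgebraicGeometry.GroupSchemes.AffineGroupScheme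
  Literature.AlgebraicGeometry.GroupSchemes.IdempotentSplitting Literature.AlgebraicGeometry.GroupSchemes.TorsionLayer
open Literature.RingTheory.DedekindDomain

/-! ## §1 `T`-points killed by an ideal: calculus for a ring action -/

section Killed

namespace RingAction

variable {S : Scheme.{u}} {𝒜 : AbelianSchemeOver S} {O : Type*} [CommRing O] (act : RingAction O 𝒜)

/-- **A point killed by the ideal `I` is FIXED by every `e ≡ 1 (mod I)`**: `t ≫ ι(e) = t` (write `e = (e − 1) + 1`; `ι` additive, `ι 1 = 𝟙`).
In print: `ι(a_m)` is the identity on `A[u^n]` for the block idempotent `a_m ≡ 1 (u^{em})`, `em ≥ n`. [cite: Neukirch1999, Ch. I §3 (3.6)] -/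
theorem comp_i_eq_self_of_sub_one_mem {I : Ideal O} {T : Over S} (t : T ⟶ 𝒜.X) (ht : ∀ b ∈ I, t ≫ act.i b = 1)
    {e : O} (he : e - 1 ∈ I) : t ≫ act.i e = t := by
  have h : e = (e - 1) + 1 := by ring
  rw [h, act.comp_i_add, ht _ he, one_mul, act.i_one, Category.comp_id]

/-- **A point killed by the ideal `I` is killed by `[N]` whenever `N ∈ I`** (`ι(N) = [N]_A`, ★ `RingAction.i_natCast`).  In print: `A[u^n] ⊆ A[p^n]`
since `p ∈ u`. [cite: MumfordAV1970, §19 Thm. 3 (p. 176)] -/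
theorem comp_mulN_eq_one_of_natCast_mem {I : Ideal O} {T : Over S} (t : T ⟶ 𝒜.X) (ht : ∀ b ∈ I, t ≫ act.i b = 1)
    {N : ℕ} (hN : (N : O) ∈ I) : t ≫ 𝒜.mulN N = 1 := by
  rw [mulN_def, ← RingAction.i_natCast act N]
  exact ht _ hN

/-- **`A[I + J] = A[I] ∩ A[J]` on `T`-points**: a point is killed by `I ⊔ J` iff it is killed by `I` and by `J` (`ι` additive).
[cite: Shimura1998, §7.5 Prop. 24 (pp. 57–58)] -/
theorem forall_mem_sup_iff {I J : Ideal O} {T : Over S} (t : T ⟶ 𝒜.X) :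
    (∀ b ∈ I ⊔ J, t ≫ act.i b = 1) ↔ (∀ b ∈ I, t ≫ act.i b = 1) ∧ ∀ b ∈ J, t ≫ act.i b = 1 := by
  constructor
  · intro h
    exact ⟨fun b hb => h b (Ideal.mem_sup_left hb), fun b hb => h b (Ideal.mem_sup_right hb)⟩
  · rintro ⟨hI, hJ⟩ b hb
    obtain ⟨x, hx, y, hy, rfl⟩ := Submodule.mem_sup.mp hb
    rw [act.comp_i_add, hI x hx, hJ y hy, one_mul]

/-- **`A[O] = 1` on `T`-points**: a point is killed by the unit ideal iff it is trivial (`ι 1 = 𝟙`). [cite: Shimura1998, §7.5 Prop. 24 (pp. 57–58)] -/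
theorem forall_mem_top_iff {T : Over S} (t : T ⟶ 𝒜.X) : (∀ b ∈ (⊤ : Ideal O), t ≫ act.i b = 1) ↔ t = 1 := by
  constructor
  · intro h
    have h1 := h 1 Submodule.mem_top
    rwa [act.i_one, Category.comp_id] at h1
  · rintro rfl b -
    haveI := act.isMonHom_i b
    exact MonObj.one_comp _

/-- **`A[(x)] = Ker ι(x)` on `T`-points**: a point is killed by the principal ideal `(x)` iff it is killed by `ι(x)` (`ι(cx) = ι(x) ≫ ι(c)`).
[cite: Shimura1998, §7.5 Prop. 24 (pp. 57–58)] -/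
theorem forall_mem_span_singleton_iff {x : O} {T : Over S} (t : T ⟶ 𝒜.X) :
    (∀ b ∈ Ideal.span {x}, t ≫ act.i b = 1) ↔ t ≫ act.i x = 1 := by
  constructor
  · intro h
    exact h x (Ideal.mem_span_singleton_self x)
  · intro hx b hb
    obtain ⟨c, rfl⟩ := Ideal.mem_span_singleton'.mp hb
    rw [act.comp_i_mul, hx]
    haveI := act.isMonHom_i c
    exact MonObj.one_comp _

end RingAction

end Killed

/-! ## §2 Landing a torsion point in a block `Fix((ι e)[N]) ⊂ A[N]` -/

section Landing

variable {S : Scheme.{u}} (𝒜 : AbelianSchemeOver S) [IsCommMonObj 𝒜.X] {O : Type*} [CommRing O] (act : RingAction O 𝒜)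

/-- **LANDING IN THE BLOCK.**  A `T`-point `t` of `A` with `[N] t = 1` and `ι(e) t = t` factors through the pin `Fix((ι e)[N]) ↪ A[N] ↪ A`
(★ `torsionLift` into `A[N]`, then the fixed-layer reading ★ `exists_comp_fixι_eq_iff` of ★ `fix`; `(ι e)[N] = torsionMap (ι e) N`, ★ `torsionMap_ι`).
[cite: Tate1997FiniteFlatGroupSchemes, (3.7)] [cite: GortzWedhorn2020, Definition 4.45 (2) (p. 117)] -/
theorem exists_fix_torsionMap_of_comp_eq (e : O) (N : ℕ) {T : Over S} (t : T ⟶ 𝒜.X) (hN : t ≫ 𝒜.mulN N = 1)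
    (he : t ≫ act.i e = t) :
    letI := 𝒜.torsionGrpObj N; haveI := act.isMonHom_i e
    ∃ x : T ⟶ fix (torsionMap (act.i e) N), (x ≫ fixι (torsionMap (act.i e) N)) ≫ 𝒜.torsionι N = t := by
  letI := 𝒜.torsionGrpObj N
  haveI := act.isMonHom_i e
  have hs : 𝒜.torsionLift t hN ≫ torsionMap (act.i e) N = 𝒜.torsionLift t hN := by
    apply 𝒜.torsion_hom_ext
    rw [Category.assoc, torsionMap_ι, ← Category.assoc, torsionLift_ι, he]
  obtain ⟨x, hx⟩ := (exists_comp_fixι_eq_iff (torsionMap (act.i e) N) (𝒜.torsionLift t hN)).2 hs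
  exact ⟨x, by rw [hx, torsionLift_ι]⟩

end Landing

/-! ## §3 The ÉTALE banal law on `u`-primary torsion points -/

section Etale

variable {k : Type u} [Field k] [IsAlgClosed k] (𝒜 : AbelianSchemeOver (Spec (.of k))) [IsCommMonObj 𝒜.X]
  {O : Type*} [CommRing O] (act : RingAction O 𝒜)

/-- **THE ÉTALE BANAL LAW, block form: `Ker F^{(r)}_{A∕k} ∩ Fix((ι e)[N]) = 1` read on `A`.**  `k = k̄`, `A` an abelian scheme over `Spec k` with a
ring action `ι` of `O`; `N ≠ 0` with `N = 0` in `k`; `e ∈ O` a CRT idempotent modulo `N` (`e² = e + N c`) whose Lie signature is ZERO (`ι(e)^* = 0` on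
`𝔪_{A,0}∕𝔪²`).  Then for every `T`-point `t` of `A` killed by `[N]` and fixed by `ι(e)` (a point of the `e`-block of `A[N]`), and every `p`, `r`:
`t ≫ F^{(r)}_{A∕k} = 1 ↔ t = 1` — ★ (C1) FILE 2 `block_comp_relFrobenius_eq_one_iff_of_lieSignature_zero` moved from the block to `A` along the two
monomorphisms (§2).  Stated with the spine tokens `relFrobeniusOver p r A.X` and `(1 : T ⟶ (A.baseChange (frobSpec k p r)).X)`.
[cite: Tate1997FiniteFlatGroupSchemes, (3.7)] [cite: RapoportSmithlingZhang2020Diagonal, §4.1 (p. 17)] [cite: Shimura1998, §13.1 Thm. 1 (pp. 97–99)] -/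
theorem comp_relFrobeniusOver_eq_one_iff_of_lieSignature_zero {N : ℕ} (hN : N ≠ 0) (hNk : (N : k) = 0) {e c : O}
    (he : e * e = e + N • c)
    (hsig0 : haveI := act.isMonHom
      Module.finrank k (LinearMap.range
        (AbelianVariety.cotangentMap 𝒜.toAffine.toAbelianVariety (InducedCategory.homMk (Grp.ofHom (A := 𝒜.X) (B := 𝒜.X) (act.i e))))) = 0)
    (p : ℕ) [ExpChar k p] (r : ℕ) {T : SchemeOver k} (t : T ⟶ 𝒜.X) (htN : t ≫ 𝒜.mulN N = 1) (hte : t ≫ act.i e = t) :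
    t ≫ relFrobeniusOver p r 𝒜.X = (1 : T ⟶ (𝒜.baseChange (frobSpec k p r)).X) ↔ t = 1 := by
  letI := 𝒜.torsionGrpObj N
  haveI := act.isMonHom
  haveI := 𝒜.isCommMonObj_torsion N
  haveI := isMonHom_torsionMap (act.i e) N
  letI := fixGrpObj (torsionMap (act.i e) N)
  haveI : IsMonHom (fixι (torsionMap (act.i e) N)) := isMonHom_fixι _
  haveI := 𝒜.isMonHom_torsionι N
  haveI := 𝒜.mono_torsionι N
  haveI := mono_fixι (torsionMap (act.i e) N)
  obtain ⟨x, hx⟩ := 𝒜.exists_fix_torsionMap_of_comp_eq act e N t htN hte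
  have key := 𝒜.block_comp_relFrobenius_eq_one_iff_of_lieSignature_zero act hN hNk he hsig0 p r x
  rw [hx] at key
  constructor
  · intro h
    have hx1 : x = 1 := key.mp h
    rw [← hx, hx1, MonObj.one_comp, MonObj.one_comp]
  · intro h
    have hx1 : x = 1 := by
      rw [← cancel_mono (fixι (torsionMap (act.i e) N)), ← cancel_mono (𝒜.torsionι N), hx, h, MonObj.one_comp,
        MonObj.one_comp]
    exact key.mpr hx1

/-- **A block idempotent is idempotent modulo `p^l` for `l ≤ m`: `a_m² = a_m + p^l c`** (★ `mul_self_sub_mem_span_pow`: `a_m² − a_m ∈ (p^m) ⊆ (p^l)`).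
[cite: Neukirch1999, Ch. I §3 (3.6)] -/
theorem _root_.Literature.RingTheory.DedekindDomain.exists_mul_self_eq_add_nsmul_of_blockFamily {O : Type*} [CommRing O]
    {p : ℕ} {u 𝔟 : Ideal O} {e' : ℕ} (hx : Ideal.span {(p : O)} = u ^ e' * 𝔟) (hcop : u ⊔ 𝔟 = ⊤)
    {a : ℕ → O} (ha1 : ∀ n, a n - 1 ∈ u ^ (e' * n)) (ha2 : ∀ n, a n ∈ 𝔟 ^ n) {m l : ℕ} (hlm : l ≤ m) :
    ∃ c : O, a m * a m = a m + (p ^ l) • c := by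
  have h := mul_self_sub_mem_span_pow hx hcop ha1 ha2 m
  have h' : a m * a m - a m ∈ Ideal.span {(p : O) ^ l} :=
    Ideal.span_singleton_le_span_singleton.mpr (pow_dvd_pow _ hlm) h
  obtain ⟨c, hc⟩ := Ideal.mem_span_singleton'.mp h'
  refine ⟨c, ?_⟩
  rw [nsmul_eq_mul, Nat.cast_pow]
  linear_combination -hc

/-- **`p^m ∈ u^n` for `n ≤ m`** from the block data `(p) = u^e 𝔟`, `e ≥ 1` (`p ∈ u`). [cite: Neukirch1999, Ch. I §3 (3.6)] -/
theorem _root_.Literature.RingTheory.DedekindDomain.natCast_pow_mem_pow_of_blockData {O : Type*} [CommRing O]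
    {p : ℕ} {u 𝔟 : Ideal O} {e' : ℕ} (he' : 0 < e') (hx : Ideal.span {(p : O)} = u ^ e' * 𝔟) {m n : ℕ} (hnm : n ≤ m) :
    ((p ^ m : ℕ) : O) ∈ u ^ n := by
  have hp : (p : O) ∈ u := by
    have h1 : (p : O) ∈ u ^ e' * 𝔟 := hx ▸ Ideal.mem_span_singleton_self _
    exact Ideal.pow_le_self he'.ne' (Ideal.mul_le_right h1)
  rw [Nat.cast_pow]
  exact Ideal.pow_le_pow_right hnm (Ideal.pow_mem_pow hp m)

/-- **THE ÉTALE BANAL LAW on `u`-primary torsion: `Ker F^{(r)}_{A∕k} ∩ A[u^n] = 1`.**  `k = k̄` of characteristic `p`, `A` an abelian scheme over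
`Spec k` with a ring action `ι` of `O`; `u ⊆ O` an ideal with block data `(p) = u^e 𝔟`, `u + 𝔟 = O`, `e ≥ 1` and block idempotents `a_m ≡ 1 (u^{em})`,
`a_m ≡ 0 (𝔟^m)` (★ `exists_blockIdempotentFamily`) of Lie signature ZERO for every `m ≥ 1` (Kottwitz signature `0` at `u`: the `u`-block of `Lie A`
vanishes — the ÉTALE case of an unmixed banal block).  Then for every `n`, `r` and every `T`-point `t` of `A` killed by `u^n`:
`t ≫ F^{(r)}_{A∕k} = 1 ↔ t = 1` (`t` is killed by `[p^{n+1}]` and fixed by `ι(a_{n+1})`; block form at `N = p^{n+1}`).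
[cite: Shimura1998, §13.1 Thm. 1 (pp. 97–99); §18.6 (p. 127)] [cite: Tate1997FiniteFlatGroupSchemes, (3.7)] [cite: RapoportSmithlingZhang2020Diagonal, §4.1 (4.6) p. 16 and p. 17] -/
theorem comp_relFrobeniusOver_eq_one_iff_eq_one_of_blockFamily (p : ℕ) [Fact p.Prime] [CharP k p]
    {u 𝔟 : Ideal O} {e' : ℕ} (he' : 0 < e') (hx : Ideal.span {(p : O)} = u ^ e' * 𝔟) (hcop : u ⊔ 𝔟 = ⊤)
    (a : ℕ → O) (ha1 : ∀ n, a n - 1 ∈ u ^ (e' * n)) (ha2 : ∀ n, a n ∈ 𝔟 ^ n)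
    (hsig0 : ∀ m, 0 < m → haveI := act.isMonHom
      Module.finrank k (LinearMap.range
        (AbelianVariety.cotangentMap 𝒜.toAffine.toAbelianVariety
          (InducedCategory.homMk (Grp.ofHom (A := 𝒜.X) (B := 𝒜.X) (act.i (a m)))))) = 0)
    (r n : ℕ) {T : SchemeOver k} (t : T ⟶ 𝒜.X) (ht : ∀ b ∈ u ^ n, t ≫ act.i b = 1) :
    t ≫ relFrobeniusOver p r 𝒜.X = (1 : T ⟶ (𝒜.baseChange (frobSpec k p r)).X) ↔ t = 1 := by
  have hp : p.Prime := Fact.out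
  -- level `N := p ^ (n + 1)`, block idempotent `a (n + 1)`
  have hN : p ^ (n + 1) ≠ 0 := pow_ne_zero _ hp.ne_zero
  have hNk : ((p ^ (n + 1) : ℕ) : k) = 0 := by
    rw [Nat.cast_pow, CharP.cast_eq_zero k p, zero_pow (Nat.succ_ne_zero n)]
  obtain ⟨c, hc⟩ := exists_mul_self_eq_add_nsmul_of_blockFamily hx hcop ha1 ha2 (le_refl (n + 1))
  have htN : t ≫ 𝒜.mulN (p ^ (n + 1)) = 1 :=
    RingAction.comp_mulN_eq_one_of_natCast_mem act t ht (natCast_pow_mem_pow_of_blockData he' hx (Nat.le_succ n))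
  have hte : t ≫ act.i (a (n + 1)) = t :=
    RingAction.comp_i_eq_self_of_sub_one_mem act t ht
      (Ideal.pow_le_pow_right (by nlinarith [he']) (ha1 (n + 1)))
  exact 𝒜.comp_relFrobeniusOver_eq_one_iff_of_lieSignature_zero act hN hNk hc (hsig0 (n + 1) (Nat.succ_pos n)) p r t htN hte

end Etale

/-! ## §4 The MULTIPLICATIVE banal law on `u`-primary torsion points -/

section Multiplicative

variable {k : Type u} [Field k] [IsAlgClosed k] (𝒜 : AbelianSchemeOver (Spec (.of k))) [IsCommMonObj 𝒜.X]
  {O : Type} [CommRing O] (act : RingAction O 𝒜)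

/-- **THE MULTIPLICATIVE BANAL LAW, block form: `Ker F^{(f)}_{A∕k} ∩ Fix((ι e)[p^f]) = Fix((ι e)[p^f])`, read on `A` as
`t ≫ F^{(f)} = 1 ↔ [p^f] t = 1` for the points fixed by `ι(e)`.**  `k = k̄` of characteristic `p`, `f ≥ 1`; `A` an abelian scheme over `Spec k` with a
ring action `ι` of `O`, a dual pair `D` and a polarization `λ` whose Rosati involution induces the ring involution `†` (`ι(b†) ≫ λ = λ ≫ ι(b)^∨`, the
spine row `rosati`) and which kills no point of `A[p^f]` (`hlam`, «`λ` prime to `p`»); `e ∈ O` with `e² = e + p^f c` whose CONJUGATE `e†` has Lie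
signature ZERO (Kottwitz signature `0` at `ū = u†`, i.e. `2 = n` at `u`: the MULTIPLICATIVE case of an unmixed banal block).  PROOF.  `⇒` is (FK0)
`Ker F^{(f)} ⊆ A[p^f]` (★ `comp_pow_zsmul_id_eq_one_of_comp_relFrobenius_eq_one`, `[p^f] = F^{(f)} ≫ V^{(f)}`).  `⇐`: on the pin `G = A[p^f]` (★ `torsion`)
the Weil isomorphism `w : Â[p^f] ≅ G^D` (★ `exists_weilIso'`, `dim Â = dim A` ★ `dim_hat_eq`, natural in endomorphisms ★ `weilHom_natural`) and the lift
`ℓ` of `λ|_G` (★ `exists_lift_lam`, an isomorphism by `hlam` ★ `isIso_lift`) give the HERMITIAN duality `e₀ = ℓ ≫ w` (★ `hermitian_of_natural`):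
`(ι e†)[q] ≫ e₀ = e₀ ≫ ((ι e)[q])^D`; the `e†`-block `Fix((ι e†)[q])` is ÉTALE (★ `etale_block_of_lieSignature_zero`), so the `e`-block is killed by
`F^{(f)}` (★ `comp_comp_comp_relFrobenius_eq_one_of_etale_conjugate`), and `t` lands in it (§2).
[cite: Shimura1998, §13.1 Thm. 1 (pp. 97–99); §18.6 (p. 127)] [cite: MumfordAV1970, §15 Thm. 1 (p. 143) and p. 146; §20 (I) (pp. 184–189)]
[cite: Tate1997FiniteFlatGroupSchemes, §(3.8) pp. 145–146, (3.7)] [cite: Demazure1972, Ch. III §6] -/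
theorem comp_relFrobeniusOver_eq_one_iff_comp_mulN_eq_one_of_conj_lieSignature_zero (p : ℕ) [Fact p.Prime] [CharP k p]
    (D : 𝒜.DualPair) (pol : 𝒜.Polarization D) (star : O →+* O)
    (hRos : ∀ b, haveI := act.isMonHom_i b
      act.i (star b) ≫ pol.lam = pol.lam ≫ DualPair.dualIsogenyOver (act.i b) D D)
    {f : ℕ} (hf : 0 < f)
    (hlam : ∀ ⦃T : SchemeOver k⦄ (t : T ⟶ 𝒜.X), t ≫ 𝒜.mulN (p ^ f) = 1 → t ≫ pol.lam = 1 → t = 1)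
    {e c : O} (he : e * e = e + (p ^ f) • c)
    (hsig0 : haveI := act.isMonHom
      Module.finrank k (LinearMap.range
        (AbelianVariety.cotangentMap 𝒜.toAffine.toAbelianVariety
          (InducedCategory.homMk (Grp.ofHom (A := 𝒜.X) (B := 𝒜.X) (act.i (star e)))))) = 0)
    {T : SchemeOver k} (t : T ⟶ 𝒜.X) (hte : t ≫ act.i e = t) :
    t ≫ relFrobeniusOver p f 𝒜.X = (1 : T ⟶ (𝒜.baseChange (frobSpec k p f)).X) ↔ t ≫ 𝒜.mulN (p ^ f) = 1 := by
  have hp : p.Prime := Fact.out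
  have hN0 : p ^ f ≠ 0 := pow_ne_zero _ hp.ne_zero
  have hNk : ((p ^ f : ℕ) : k) = 0 := by
    rw [Nat.cast_pow, CharP.cast_eq_zero k p, zero_pow hf.ne']
  constructor
  · -- (FK0): `Ker F^{(f)} ⊆ A[p^f]`
    intro h
    rw [mulN_eq_hom_zsmul_id]
    exact comp_pow_zsmul_id_eq_one_of_comp_relFrobenius_eq_one p 𝒜.toAffine.toAbelianVariety f t h
  · intro hq
    -- (0) the abelian variety `A`, the unit hypothesis, the torsion pin `G = A[p^f]` (★ `torsion`) and the dual pin `Ĝ = Â[p^f]`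
    let A : AbelianVariety k := 𝒜.toAffine.toAbelianVariety
    have hD : Nonempty ((Scheme.Modules.pullback (DualPair.unitHatSlice D)).obj D.P ≅ SheafOfModules.unit _) :=
      pol.nonempty_unitHatSlice_iso
    letI := 𝒜.torsionGrpObj (p ^ f)
    haveI := act.isMonHom
    haveI := 𝒜.isCommMonObj_torsion (p ^ f)
    haveI : IsFinite (𝒜.torsion (p ^ f)).hom := 𝒜.isFinite_torsion_hom hN0
    haveI : IsAffine (𝒜.torsion (p ^ f)).left := isAffine_left_of_isAffineHom (𝒜.torsion (p ^ f))
    haveI : Module.Finite k (Alg (𝒜.torsion (p ^ f))) := Alg.moduleFinite (𝒜.torsion (p ^ f))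
    haveI := 𝒜.isMonHom_torsionι (p ^ f)
    haveI := 𝒜.isClosedImmersion_torsionι_left (p ^ f)
    haveI := 𝒜.mono_torsionι (p ^ f)
    have hG : ∀ ⦃T : SchemeOver k⦄ (s : T ⟶ A.X),
        (∃ s' : T ⟶ 𝒜.torsion (p ^ f), s' ≫ 𝒜.torsionι (p ^ f) = s) ↔ s ≫ ((((p ^ f : ℕ) : ℤ) • 𝟙 A).hom.hom.hom) = 1 := by
      intro T s
      rw [← mulN_eq_hom_zsmul_id]
      exact GroupSchemeKernel.exists_comp_kerι_eq_iff (𝒜.mulN (p ^ f)) s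
    obtain ⟨Ĝ, l1, l2, l3, l4, l5, ĵ, l6, l7, hĜ⟩ :=
      D.hat.toAffine.toAbelianVariety.exists_torsionPin (N := p ^ f) hN0
    -- (1) the Weil isomorphism `w : Ĝ ≅ G^D`, natural in endomorphisms (★ `exists_weilIso'`, ★ `weilHom_natural`, ★ `dim_hat_eq`)
    obtain ⟨w, hw, hpair⟩ := WeilPairing.exists_weilIso' p f A D hD (DualPair.dim_hat_eq A D) (𝒜.torsion (p ^ f))
      (𝒜.torsionι (p ^ f)) hG Ĝ ĵ hĜ
    haveI := hw
    have hnat : ∀ (φ : A ⟶ A) (β' : 𝒜.torsion (p ^ f) ⟶ 𝒜.torsion (p ^ f)) [IsMonHom β'],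
        β' ≫ 𝒜.torsionι (p ^ f) = 𝒜.torsionι (p ^ f) ≫ φ.hom.hom.hom →
        ∀ (βd : Ĝ ⟶ Ĝ), βd ≫ ĵ = ĵ ≫ DualPair.dualIsogenyOver (A' := (AbelianScheme.ofAbelianVariety A).toOver)
          (B := (AbelianScheme.ofAbelianVariety A).toOver) φ.hom.hom.hom D D → βd ≫ w.hom = w.hom ≫ cartierDualMap β' :=
      fun φ β' _ hβ' βd hβd =>
        WeilPairing.weilHom_natural (p ^ f) A A D D hD hD φ (𝒜.torsion (p ^ f)) (𝒜.torsionι (p ^ f)) hG Ĝ ĵ hĜ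
          (𝒜.torsion (p ^ f)) (𝒜.torsionι (p ^ f)) hG Ĝ ĵ hĜ β' hβ' βd hβd w.hom hpair w.hom hpair
    -- (2) the lift `ℓ` of `λ|_{A[q]}`, an isomorphism by `hlam`; the hermitian duality `e₀ := ℓ ≫ w`
    obtain ⟨ℓ, hℓ⟩ := DualPair.exists_lift_lam p f A D pol (𝒜.torsionι (p ^ f)) hG ĵ hĜ
    have hlamG : ∀ ⦃T : SchemeOver k⦄ (s : T ⟶ 𝒜.torsion (p ^ f)), (s ≫ 𝒜.torsionι (p ^ f)) ≫ pol.lam = 1 → s = 1 := by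
      intro T s hs
      have h1 : (s ≫ 𝒜.torsionι (p ^ f)) ≫ 𝒜.mulN (p ^ f) = 1 := by
        rw [Category.assoc, torsionι_comp_mulN, MonObj.comp_one]
      rw [← cancel_mono (𝒜.torsionι (p ^ f)), MonObj.one_comp]
      exact hlam _ h1 hs
    haveI := DualPair.isIso_lift (A := A) (D := D) pol hlamG ℓ hℓ w
    haveI := DualPair.isMonHom_lift (A := A) (D := D) pol ℓ hℓ
    let act' : O → (A ⟶ A) := fun b => homOfIsMonHom (act.i b)
    let β : O → (𝒜.torsion (p ^ f) ⟶ 𝒜.torsion (p ^ f)) := fun b => torsionMap (act.i b) (p ^ f)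
    haveI hβm : ∀ b, IsMonHom (β b) := fun b => isMonHom_torsionMap (act.i b) (p ^ f)
    have hβ : ∀ b, β b ≫ 𝒜.torsionι (p ^ f) = 𝒜.torsionι (p ^ f) ≫ (act' b).hom.hom.hom := fun b =>
      torsionMap_ι (act.i b) (p ^ f)
    have hRos' : ∀ b, (act' (star b)).hom.hom.hom ≫ pol.lam =
        pol.lam ≫ DualPair.dualIsogenyOver (A' := (AbelianScheme.ofAbelianVariety A).toOver)
          (B := (AbelianScheme.ofAbelianVariety A).toOver) (act' b).hom.hom.hom D D := fun b => hRos b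
    have hherm : β (star e) ≫ (ℓ ≫ w.hom) = (ℓ ≫ w.hom) ≫ cartierDualMap (β e) :=
      DualPair.hermitian_of_natural p f A D hD pol hĜ ℓ hℓ star act' β hβ hRos' w hnat e
    let e₀ : 𝒜.torsion (p ^ f) ≅ cartierDual (𝒜.torsion (p ^ f)) := asIso ℓ ≪≫ w
    haveI he₀ : IsMonHom e₀.hom := by
      change IsMonHom (ℓ ≫ w.hom)
      infer_instance
    have hadj : β (star e) ≫ e₀.hom = e₀.hom ≫ cartierDualMap (β e) := hherm
    -- (3) the two block idempotents and their fixed layers; the conjugate block `W` is ÉTALE (★ FILE 2)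
    have h𝒢𝒢 : β e ≫ β e = β e := 𝒜.torsionMap_i_idem_of_mul_self_eq act (p ^ f) he
    have heW : star e * star e = star e + (p ^ f) • star c := mul_self_eq_add_nsmul_star star he
    have hWW : β (star e) ≫ β (star e) = β (star e) := 𝒜.torsionMap_i_idem_of_mul_self_eq act (p ^ f) heW
    letI := fixGrpObj (β (star e))
    letI := fixGrpObj (β e)
    haveI : IsMonHom (fixι (β (star e))) := isMonHom_fixι _
    haveI : IsMonHom (fixι (β e)) := isMonHom_fixι _
    haveI : IsClosedImmersion (fixι (β (star e))).left := isClosedImmersion_fixι_left _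
    haveI : IsClosedImmersion (fixι (β e)).left := isClosedImmersion_fixι_left _
    haveI : Etale (fix (β (star e))).hom := 𝒜.etale_block_of_lieSignature_zero act hN0 hNk heW hsig0
    haveI : IsCommMonObj (fix (β e)) := isCommMonObj_fix _
    haveI : IsAffine (fix (β e)).left := isAffine_fix_left _
    haveI : Module.Finite k (Alg (fix (β e))) := finite_alg_fix _
    have hq' : (𝟙 (𝒜.torsion (p ^ f))) ^ (p ^ f) = 1 := 𝒜.id_pow_eq_one_torsion (p ^ f)
    -- (4) land `t` in the `u`-block and apply the multiplicative law ★ FILE 3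
    obtain ⟨x, hx⟩ := 𝒜.exists_fix_torsionMap_of_comp_eq act e (p ^ f) t hq hte
    have law := AbelianVariety.comp_comp_comp_relFrobenius_eq_one_of_etale_conjugate p f A (𝒜.torsion (p ^ f))
      (𝒜.torsionι (p ^ f)) hq' e₀ (β (star e)) (β e) hWW h𝒢𝒢 hadj (fix (β (star e))) (fixι (β (star e)))
      (fun _ y => exists_comp_fixι_eq_iff (β (star e)) y) (fix (β e)) (fixι (β e))
      (fun _ y => exists_comp_fixι_eq_iff (β e) y) x
    rw [hx] at law
    exact law

/-- **(P-1) «`λ` PRIME TO `p` KILLS NO POINT OF `A[N]`» from a quasi-inverse: `[N] t = 1 ∧ λ t = 1 ⟹ t = 1` when `λ ≫ ν = [d]` with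
`gcd(N, d) = 1`** (any base: `t ≫ [d] = t ≫ λ ≫ ν = 1`, then Bezout in the group of `T`-points, Mathlib `pow_gcd_eq_one`).  The spine row `polQuasiInv`
(`∃ d ν, IsMonHom ν ∧ p.Coprime d ∧ λ ≫ ν = [d]`) base-changed to the point (★ `baseChangeHom_comp_eq_mulN`) is the input.
[cite: MumfordAV1970, §6 Application 3 (p. 64)] [cite: Liu2021, Rem. C.13 (p. 112); Def. C.19 (pp. 116–117)] -/
theorem eq_one_of_comp_mulN_of_comp_lam_of_quasiInverse {S : Scheme.{u}} (A₀ : AbelianSchemeOver S) (D₀ : A₀.DualPair)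
    (lam : A₀.X ⟶ D₀.hat.X) {N d : ℕ} (hNd : N.Coprime d) (ν : D₀.hat.X ⟶ A₀.X) [IsMonHom ν] (hν : lam ≫ ν = A₀.mulN d)
    ⦃T : Over S⦄ (t : T ⟶ A₀.X) (hN : t ≫ A₀.mulN N = 1) (hlam : t ≫ lam = 1) : t = 1 := by
  have hd : t ≫ A₀.mulN d = 1 := by rw [← hν, ← Category.assoc, hlam, MonObj.one_comp]
  rw [AbelianSchemeOver.mulN_def, MonObj.comp_pow, Category.comp_id] at hN hd
  have h := pow_gcd_eq_one.2 ⟨hN, hd⟩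
  rwa [Nat.Coprime.gcd_eq_one hNd, pow_one] at h

/-- **THE MULTIPLICATIVE BANAL LAW on `u`-primary torsion: `Ker F^{(f)}_{A∕k} ∩ A[u^n] = A[p^f] ∩ A[u^n]`.**  `k = k̄` of characteristic `p`,
`f ≥ 1`; `A` over `Spec k` with a ring action `ι` of `O`, a dual pair `D`, a polarization `λ` with ROSATI `ι(b†) ≫ λ = λ ≫ ι(b)^∨` for a ring
involution `†` of `O` and QUASI-INVERSE `λ ≫ ν = [d]`, `p ∤ d` (the spine rows `rosati`, `polQuasiInv`); `u ⊆ O` with block data `(p) = u^e 𝔟`,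
`u + 𝔟 = O`, `e ≥ 1`, block idempotents `a_m`, and the CONJUGATE family `a_m†` of Lie signature ZERO for every `m ≥ 1` (the `u†`-block of `Lie A`
vanishes: Kottwitz signature `2` on the embeddings inducing `u`, `0` on those inducing `u†`).  Then for every `n` and every `T`-point `t` of `A` killed
by `u^n`: `t ≫ F^{(f)}_{A∕k} = 1 ↔ t ≫ [p^f] = 1` (block form at `e := a_{n+f}`, idempotent modulo `p^f` and fixing `t`).
[cite: Shimura1998, §13.1 Thm. 1 (pp. 97–99); §18.6 (p. 127)] [cite: RapoportSmithlingZhang2020Diagonal, §4.1 (4.6) p. 16 and p. 17]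
[cite: MumfordAV1970, §20 (I) (pp. 184–189)] [cite: Tate1997FiniteFlatGroupSchemes, §(3.8) pp. 145–146] -/
theorem comp_relFrobeniusOver_eq_one_iff_comp_mulN_eq_one_of_blockFamily (p : ℕ) [Fact p.Prime] [CharP k p]
    (D : 𝒜.DualPair) (pol : 𝒜.Polarization D) (star : O →+* O)
    (hRos : ∀ b, haveI := act.isMonHom_i b
      act.i (star b) ≫ pol.lam = pol.lam ≫ DualPair.dualIsogenyOver (act.i b) D D)
    {f : ℕ} (hf : 0 < f) {d : ℕ} (hpd : p.Coprime d) (ν : D.hat.X ⟶ 𝒜.X) [IsMonHom ν] (hν : pol.lam ≫ ν = 𝒜.mulN d)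
    {u 𝔟 : Ideal O} {e' : ℕ} (he' : 0 < e') (hx : Ideal.span {(p : O)} = u ^ e' * 𝔟) (hcop : u ⊔ 𝔟 = ⊤)
    (a : ℕ → O) (ha1 : ∀ n, a n - 1 ∈ u ^ (e' * n)) (ha2 : ∀ n, a n ∈ 𝔟 ^ n)
    (hsig0 : ∀ m, 0 < m → haveI := act.isMonHom
      Module.finrank k (LinearMap.range
        (AbelianVariety.cotangentMap 𝒜.toAffine.toAbelianVariety
          (InducedCategory.homMk (Grp.ofHom (A := 𝒜.X) (B := 𝒜.X) (act.i (star (a m))))))) = 0)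
    (n : ℕ) {T : SchemeOver k} (t : T ⟶ 𝒜.X) (ht : ∀ b ∈ u ^ n, t ≫ act.i b = 1) :
    t ≫ relFrobeniusOver p f 𝒜.X = (1 : T ⟶ (𝒜.baseChange (frobSpec k p f)).X) ↔ t ≫ 𝒜.mulN (p ^ f) = 1 := by
  -- block idempotent `a m` at `m := n + f` (`m ≥ n`: `ι(a m)` fixes `t`; `m ≥ f`: `a m` is idempotent modulo `p ^ f`)
  obtain ⟨c, hc⟩ := exists_mul_self_eq_add_nsmul_of_blockFamily hx hcop ha1 ha2 (Nat.le_add_left f n)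
  have hte : t ≫ act.i (a (n + f)) = t :=
    RingAction.comp_i_eq_self_of_sub_one_mem act t ht (Ideal.pow_le_pow_right (by nlinarith [he']) (ha1 (n + f)))
  have hlam : ∀ ⦃T : SchemeOver k⦄ (s : T ⟶ 𝒜.X), s ≫ 𝒜.mulN (p ^ f) = 1 → s ≫ pol.lam = 1 → s = 1 := fun _ s hs hl =>
    eq_one_of_comp_mulN_of_comp_lam_of_quasiInverse 𝒜 D pol.lam (Nat.Coprime.pow_left f hpd) ν hν s hs hl
  exact 𝒜.comp_relFrobeniusOver_eq_one_iff_comp_mulN_eq_one_of_conj_lieSignature_zero act p D pol star hRos hf hlam hc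
    (hsig0 (n + f) (by omega)) t hte

end Multiplicative

/-! ## §5 The two `FrobKernelBanal₀`-shaped laws: `Ker F^{(f)} ∩ (u-primary) = A[𝔞] ∩ (u-primary)` -/

section Heads

variable {k : Type u} [Field k] [IsAlgClosed k] (𝒜 : AbelianSchemeOver (Spec (.of k))) [IsCommMonObj 𝒜.X]
  {O : Type} [CommRing O] (act : RingAction O 𝒜)

/-- **HEAD (ÉTALE BANAL BLOCK), `FrobKernelBanal₀` shape: on `u^n`-torsion points, `t ≫ F^{(f)}_{A∕k} = 1 ↔ ∀ b ∈ 𝔞, t ≫ ι(b) = 1` whenever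
`u^n + 𝔞 = O`** (both sides say `t = 1`: the left by the étale law §3, the right because `t` is killed by `u^n + 𝔞 = O`).  Hypotheses: `k = k̄` of
characteristic `p`, block data of `u` with `e ≥ 1`, block idempotents of Lie signature `0` (étale `u`-block); `𝔞` prime to `u` at level `n` — for the
canonical twist ideal of a Frobenius this is ★ `pow_sup_prod_filter_ker_eq_top_of_forall_eq_zero` (`∀ τ ↦ u, r_τ = 0`).  The P-side payment of the
spine row (π2-G) `frobKernel_banal` on an étale banal block. [cite: Shimura1998, §13.1 Thm. 1 (pp. 97–99); §18.6 (p. 127)]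
[cite: Tate1997FiniteFlatGroupSchemes, (3.7)] [cite: RapoportSmithlingZhang2020Diagonal, §4.1 (4.6) p. 16 and p. 17] -/
theorem frobKernelBanal_of_lieSignature_zero (p : ℕ) [Fact p.Prime] [CharP k p]
    {u 𝔟 : Ideal O} {e' : ℕ} (he' : 0 < e') (hx : Ideal.span {(p : O)} = u ^ e' * 𝔟) (hcop : u ⊔ 𝔟 = ⊤)
    (a : ℕ → O) (ha1 : ∀ n, a n - 1 ∈ u ^ (e' * n)) (ha2 : ∀ n, a n ∈ 𝔟 ^ n)
    (hsig0 : ∀ m, 0 < m → haveI := act.isMonHom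
      Module.finrank k (LinearMap.range
        (AbelianVariety.cotangentMap 𝒜.toAffine.toAbelianVariety
          (InducedCategory.homMk (Grp.ofHom (A := 𝒜.X) (B := 𝒜.X) (act.i (a m)))))) = 0)
    (f n : ℕ) {𝔞 : Ideal O} (h𝔞 : u ^ n ⊔ 𝔞 = ⊤) {T : SchemeOver k} (t : T ⟶ 𝒜.X) (ht : ∀ b ∈ u ^ n, t ≫ act.i b = 1) :
    t ≫ relFrobeniusOver p f 𝒜.X = (1 : T ⟶ (𝒜.baseChange (frobSpec k p f)).X) ↔ ∀ b ∈ 𝔞, t ≫ act.i b = 1 := by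
  rw [𝒜.comp_relFrobeniusOver_eq_one_iff_eq_one_of_blockFamily act p he' hx hcop a ha1 ha2 hsig0 f n t ht]
  constructor
  · rintro rfl b -
    haveI := act.isMonHom_i b
    exact MonObj.one_comp _
  · intro h𝔞t
    have htop : ∀ b ∈ (⊤ : Ideal O), t ≫ act.i b = 1 := by
      rw [← h𝔞, RingAction.forall_mem_sup_iff act t]
      exact ⟨ht, h𝔞t⟩
    exact (RingAction.forall_mem_top_iff act t).1 htop

/-- **HEAD (MULTIPLICATIVE BANAL BLOCK), `FrobKernelBanal₀` shape: on `u^n`-torsion points, `t ≫ F^{(f)}_{A∕k} = 1 ↔ ∀ b ∈ 𝔞, t ≫ ι(b) = 1`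
whenever `u^n + 𝔞 = u^n + (p^f)`** (both sides say `[p^f] t = 1`: the left by the multiplicative law §4, the right because on `u^n`-torsion «killed by `𝔞`»
= «killed by `𝔞 + u^n = (p^f) + u^n`» = «killed by `ι(p^f) = [p^f]`»).  Hypotheses: `k = k̄` of characteristic `p`, `f ≥ 1`, ROSATI for `†`, the (P-1)
quasi-inverse `λ ≫ ν = [d]` with `p ∤ d`, block data of `u` with `e ≥ 1`, conjugate block idempotents `a_m†` of Lie signature `0` (multiplicative
`u`-block); `ord_u 𝔞 = ord_u (p^f)` at level `n` — for the canonical twist ideal of a Frobenius this is ★ `pow_sup_prod_filter_ker_eq_of_forall_ne_zero`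
with `N𝔭_w = p^f` (`∀ τ ↦ u, r_τ ≠ 0`).  The P-side payment of the spine row (π2-G) `frobKernel_banal` on a multiplicative banal block.
[cite: Shimura1998, §13.1 Thm. 1 (pp. 97–99); §18.6 (p. 127)] [cite: MumfordAV1970, §15 Thm. 1 (p. 143); §20 (I) (pp. 184–189)]
[cite: Tate1997FiniteFlatGroupSchemes, §(3.8) pp. 145–146] [cite: RapoportSmithlingZhang2020Diagonal, §4.1 (4.6) p. 16 and p. 17] -/
theorem frobKernelBanal_of_conj_lieSignature_zero (p : ℕ) [Fact p.Prime] [CharP k p]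
    (D : 𝒜.DualPair) (pol : 𝒜.Polarization D) (star : O →+* O)
    (hRos : ∀ b, haveI := act.isMonHom_i b
      act.i (star b) ≫ pol.lam = pol.lam ≫ DualPair.dualIsogenyOver (act.i b) D D)
    {f : ℕ} (hf : 0 < f) {d : ℕ} (hpd : p.Coprime d) (ν : D.hat.X ⟶ 𝒜.X) [IsMonHom ν] (hν : pol.lam ≫ ν = 𝒜.mulN d)
    {u 𝔟 : Ideal O} {e' : ℕ} (he' : 0 < e') (hx : Ideal.span {(p : O)} = u ^ e' * 𝔟) (hcop : u ⊔ 𝔟 = ⊤)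
    (a : ℕ → O) (ha1 : ∀ n, a n - 1 ∈ u ^ (e' * n)) (ha2 : ∀ n, a n ∈ 𝔟 ^ n)
    (hsig0 : ∀ m, 0 < m → haveI := act.isMonHom
      Module.finrank k (LinearMap.range
        (AbelianVariety.cotangentMap 𝒜.toAffine.toAbelianVariety
          (InducedCategory.homMk (Grp.ofHom (A := 𝒜.X) (B := 𝒜.X) (act.i (star (a m))))))) = 0)
    (n : ℕ) {𝔞 : Ideal O} (h𝔞 : u ^ n ⊔ 𝔞 = u ^ n ⊔ Ideal.span {((p ^ f : ℕ) : O)})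
    {T : SchemeOver k} (t : T ⟶ 𝒜.X) (ht : ∀ b ∈ u ^ n, t ≫ act.i b = 1) :
    t ≫ relFrobeniusOver p f 𝒜.X = (1 : T ⟶ (𝒜.baseChange (frobSpec k p f)).X) ↔ ∀ b ∈ 𝔞, t ≫ act.i b = 1 := by
  rw [𝒜.comp_relFrobeniusOver_eq_one_iff_comp_mulN_eq_one_of_blockFamily act p D pol star hRos hf hpd ν hν he' hx hcop a ha1 ha2
    hsig0 n t ht]
  have key : (∀ b ∈ 𝔞, t ≫ act.i b = 1) ↔ ∀ b ∈ Ideal.span {((p ^ f : ℕ) : O)}, t ≫ act.i b = 1 := by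
    constructor
    · intro h
      have h2 : ∀ b ∈ u ^ n ⊔ Ideal.span {((p ^ f : ℕ) : O)}, t ≫ act.i b = 1 := by
        rw [← h𝔞, RingAction.forall_mem_sup_iff act t]
        exact ⟨ht, h⟩
      exact ((RingAction.forall_mem_sup_iff act t).1 h2).2
    · intro h
      have h2 : ∀ b ∈ u ^ n ⊔ 𝔞, t ≫ act.i b = 1 := by
        rw [h𝔞, RingAction.forall_mem_sup_iff act t]
        exact ⟨ht, h⟩
      exact ((RingAction.forall_mem_sup_iff act t).1 h2).2
  rw [key, RingAction.forall_mem_span_singleton_iff act t, AbelianSchemeOver.mulN_def, ← RingAction.i_natCast act (p ^ f)]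

omit [IsAlgClosed k] [IsCommMonObj 𝒜.X] in
/-- **The valuation shape of `𝔞` gives the multiplicative hypothesis**: `𝔞 = u^{ef} 𝔟′` with `u + 𝔟′ = O` and `(p) = u^e 𝔟`, `u + 𝔟 = O` imply
`u^n + 𝔞 = u^n + (p^f)` for every `n` (both equal `u^n + u^{ef}`: a factor prime to `u` is absorbed, `u^d 𝔠 + u^n = u^d + u^n`).
[cite: Neukirch1999, Ch. I §3 (3.6)] -/
theorem _root_.Literature.RingTheory.DedekindDomain.pow_sup_eq_pow_sup_span_pow_of_eq_pow_mul {O : Type*} [CommRing O]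
    {p : ℕ} {u 𝔟 𝔟' 𝔞 : Ideal O} {e' f : ℕ} (hx : Ideal.span {(p : O)} = u ^ e' * 𝔟) (hcop : u ⊔ 𝔟 = ⊤)
    (h𝔞 : 𝔞 = u ^ (e' * f) * 𝔟') (hcop' : u ⊔ 𝔟' = ⊤) (n : ℕ) :
    u ^ n ⊔ 𝔞 = u ^ n ⊔ Ideal.span {((p ^ f : ℕ) : O)} := by
  rw [sup_comm (u ^ n) 𝔞, sup_comm (u ^ n)]
  -- `u^d 𝔠 ⊔ u^n = u^d ⊔ u^n` for every `𝔠` prime to `u`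
  have aux : ∀ {𝔠 : Ideal O} (d : ℕ), u ⊔ 𝔠 = ⊤ → u ^ d * 𝔠 ⊔ u ^ n = u ^ d ⊔ u ^ n := by
    intro 𝔠 d h𝔠
    apply le_antisymm
    · exact sup_le_sup_right Ideal.mul_le_right _
    · refine sup_le ?_ le_sup_right
      have hcn : 𝔠 ⊔ u ^ n = ⊤ := by
        rw [sup_comm, ← pow_one 𝔠]
        exact pow_sup_pow_eq_top h𝔠 n 1
      calc u ^ d = u ^ d * (𝔠 ⊔ u ^ n) := by rw [hcn, Ideal.mul_top]
        _ = u ^ d * 𝔠 ⊔ u ^ d * u ^ n := Ideal.mul_sup _ _ _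
        _ ≤ u ^ d * 𝔠 ⊔ u ^ n := sup_le_sup_left Ideal.mul_le_left _
  have h1 : u ⊔ 𝔟 ^ f = ⊤ := by
    have h := pow_sup_pow_eq_top hcop 1 f
    rwa [pow_one] at h
  rw [h𝔞, Nat.cast_pow, ← Ideal.span_singleton_pow, hx, mul_pow, ← pow_mul, aux (e' * f) hcop', aux (e' * f) h1]

end Heads

end Literature.AlgebraicGeometry.AbelianSchemes.AbelianSchemeOver

end
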